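import Summits.ABC.Harvest.BakerXi
import Summits.ABC.Harvest.GlueBaker
import Summits.ABC.ABC.Theorems.SoloInformedBakerXi
import HarnessLib

/-!
# ABC harvest — GLUE for door C9 (I): Baker's `ε`-form ⟺ `ω`-form (both labellings), `ε`-form ⟹ abc

`Summits/ABC/Harvest/GlueBakerXi.lean` — cell `abc-harv`, seat abc-harv-pr-2 (KEY PR-BAKERXI), namespace
`Summit.ABC.Harvest`. PROOF-ONLY companion of `BakerXi.lean` (no definition, no `sorry`, no axiom, no named
fact: every arrow below is elementary and fully proved).

* §1 (cell / SUMMAND labelling `ω(a·b)` on `a + b = c`):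
  `bakerRefinedABC_iff_bakerOmegaConjecture : BakerRefinedABC ↔ BakerOmegaConjecture` — Baker 1998's
  `ε`-form `c ≤ K ε^{−κω} N^{1+ε}` (all `ε > 0`) versus Baker 2004's Conj. 3 `c ≤ K N ((log N)/ω)^{κω}`
  («en optimisant sur `ε`», Philippon 1999 p. 331; Granville's `ε = κω/log N`, Waldschmidt 2014 §5).
  `⇒`: plug `ε = κω/L` and absorb `(e/κ)^{κω}` by raising `κ` to `κ + 1`
  (`BakerXi.exists_const_rpow_le_mul_div_rpow`, via `ω log ω − ω ≤ log ω! ≤ log N`); `⇐`: for EVERY `ε > 0`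
  by `BakerXi.exists_div_rpow_le_eps_form`. Corollary `abc_of_bakerRefinedABC` (through
  `bakerOmega_imp_abc`, `GlueBaker.lean`).
* §2 (Baker's PAIR labelling `ω(c·a)`, forced by the `Ξ`-dictionary `Λ = log(c/a)`, `c − a = b`):
  `refinedPairs_iff_omegaPairs` — the same optimisation in the pair labelling; the `ω`-form is VERBATIM
  the hypothesis of `Summit.ABC.ABC.Theorems.soloInformed_abc_of_bakerConj3`. The `Ξ`-form proper
  (`BakerXiConjecture ↔` these, `→ ABC`, `→ XiLowerBound`) is the third file `GlueBakerXiForm.lean`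
  (400-line cap).
* §0 the pointwise (per-triple) versions `le_omegaForm_of_epsForm` / `le_epsForm_of_omegaForm` over the
  toolkit of `BakerXi.lean` (`BakerXi.optimal_eps_identity`, `.exists_const_rpow_le_mul_div_rpow`,
  `.exists_div_rpow_le_eps_form`), valid for any weight `k` with `2^k ≤ N`, `k! ≤ N`.

NOT PROVED, NOT CLAIMED: any arrow between the summand-labelled (`BakerOmegaConjecture`, `BakerRefinedABC`)
and the pair-labelled statements (`BakerXiConjecture` and its equivalents) — Baker «does not specify on
which two variables» (van Frankenhuijsen 2012 p. 178); `ABC ⟹` any of them (they are refinements).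
HONESTY LINE: abc is not proved by any of this (A0 doors: stronger hypothesis ⟹ abc); typed ≠ proved;
A-PS is NOT abc — «NOT abc — POLY-SZPIRO(E)».
-/

noncomputable section

open Real UniqueFactorizationMonoid
open scoped ArithmeticFunction.omega Nat

namespace Summit.ABC.Harvest

open Literature.NumberTheory.DiophantineGeometry
open Summit.ABC.ABC.Theorems

/-! ## §0 Per-triple bookkeeping -/

/-- `2^{ω(m)} ≤ rad(abc)` for every divisor `m` of `abc` (abc triple). [folklore] -/
theorem two_pow_cardDistinctFactors_le_rad_of_dvd {a b c m : ℕ} (ht : IsABCTriple a b c)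
    (hm : m ∣ a * b * c) : 2 ^ ω m ≤ rad a b c := by
  obtain ⟨ha, hb, hc, -⟩ := soloInformed_xi_triple_pos ht
  have hn0 : a * b * c ≠ 0 := by positivity
  have h1 : ω m ≤ ω (a * b * c) := by
    rw [cardDistinctFactors_eq_card_primeFactors, cardDistinctFactors_eq_card_primeFactors]
    exact Finset.card_le_card (Nat.primeFactors_mono hm hn0)
  calc 2 ^ ω m ≤ 2 ^ ω (a * b * c) := Nat.pow_le_pow_right (by norm_num) h1
    _ ≤ radical (a * b * c) := BakerXi.two_pow_cardDistinctFactors_le_radical _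
    _ = rad a b c := (rad_def a b c).symm

/-- `ω(m)! ≤ rad(abc)` for every divisor `m` of `abc` (abc triple). [folklore] -/
theorem factorial_cardDistinctFactors_le_rad_of_dvd {a b c m : ℕ} (ht : IsABCTriple a b c)
    (hm : m ∣ a * b * c) : (ω m)! ≤ rad a b c := by
  obtain ⟨ha, hb, hc, -⟩ := soloInformed_xi_triple_pos ht
  have hn0 : a * b * c ≠ 0 := by positivity
  have h1 : ω m ≤ ω (a * b * c) := by
    rw [cardDistinctFactors_eq_card_primeFactors, cardDistinctFactors_eq_card_primeFactors]
    exact Finset.card_le_card (Nat.primeFactors_mono hm hn0)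
  have h2 := factorial_cardDistinctFactors_le_radical (a * b * c)
  rw [← rad_def] at h2
  exact (Nat.factorial_le h1).trans h2

/-- **Pointwise `ε`-form ⟹ `ω`-form.** If `c ≤ K ε^{−κk} N^{1+ε}` for every `ε > 0` (`k ≥ 1`, `2^k ≤ N`,
`k! ≤ N`), then `c ≤ K·C′·N·((log N)/k)^{(κ+1)k}`, where `C′` absorbs `max(1,(e/κ)^κ)^k`
(`BakerXi.exists_const_rpow_le_mul_div_rpow`): Granville's `ε = κk/log N`. [cite: Waldschmidt2014, §5] -/
theorem le_omegaForm_of_epsForm {κ K C' : ℝ} (hκ : 0 < κ) (hK : 0 ≤ K)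
    (hC' : ∀ w L : ℝ, 1 ≤ w → w * Real.log 2 ≤ L → w * Real.log w - w ≤ L →
      (max 1 ((Real.exp 1 / κ) ^ κ)) ^ w ≤ C' * (L / w) ^ w)
    {a b c k : ℕ} (ht : IsABCTriple a b c) (hk : 1 ≤ k) (h2 : 2 ^ k ≤ rad a b c)
    (hf : k ! ≤ rad a b c)
    (hE : ∀ ε : ℝ, 0 < ε → (c : ℝ) ≤ K * ε ^ (-(κ * (k : ℝ))) * ((rad a b c : ℕ) : ℝ) ^ (1 + ε)) :
    (c : ℝ) ≤ K * C' * ((rad a b c : ℕ) : ℝ) *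
      (Real.log ((rad a b c : ℕ) : ℝ) / (k : ℝ)) ^ ((κ + 1) * (k : ℝ)) := by
  set N : ℝ := ((rad a b c : ℕ) : ℝ) with hN
  set w : ℝ := (k : ℝ) with hw
  set L : ℝ := Real.log N with hL
  have hN2 : (2 : ℝ) ≤ N := by rw [hN]; exact_mod_cast ht.two_le_rad
  have hN0 : 0 < N := by linarith
  have hL0 : 0 < L := Real.log_pos (by linarith)
  have hw1 : (1 : ℝ) ≤ w := by rw [hw]; exact_mod_cast hk
  have hw0 : 0 < w := by linarith
  have hlog2 : w * Real.log 2 ≤ L := BakerXi.mul_log_two_le_log h2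
  have hfac : w * Real.log w - w ≤ L := BakerXi.mul_log_sub_le_log hf
  have hs0 : 0 < L / w := div_pos hL0 hw0
  -- Granville's `ε`
  set ε : ℝ := κ * w / L with hε
  have hε0 : 0 < ε := by positivity
  have h1 := hE ε hε0
  have hsplit : N ^ (1 + ε) = N * Real.exp (ε * L) := by
    rw [Real.rpow_add hN0, Real.rpow_one, Real.rpow_def_of_pos hN0, hL, mul_comm (Real.log N)]
  have hopt : ε ^ (-(κ * w)) * Real.exp (ε * L) =
      (Real.exp 1 / κ) ^ (κ * w) * (L / w) ^ (κ * w) := by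
    rw [hε]; exact BakerXi.optimal_eps_identity hκ hw0 hL0
  have heκ : 0 ≤ Real.exp 1 / κ := by positivity
  have habs : (Real.exp 1 / κ) ^ (κ * w) ≤ C' * (L / w) ^ w := by
    calc (Real.exp 1 / κ) ^ (κ * w) = ((Real.exp 1 / κ) ^ κ) ^ w := Real.rpow_mul heκ κ w
      _ ≤ (max 1 ((Real.exp 1 / κ) ^ κ)) ^ w :=
          Real.rpow_le_rpow (Real.rpow_nonneg heκ κ) (le_max_right _ _) hw0.le
      _ ≤ C' * (L / w) ^ w := hC' w L hw1 hlog2 hfac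
  have hpow : (L / w) ^ w * (L / w) ^ (κ * w) = (L / w) ^ ((κ + 1) * w) := by
    rw [← Real.rpow_add hs0]; ring_nf
  have hX0 : 0 ≤ (L / w) ^ (κ * w) := Real.rpow_nonneg hs0.le _
  calc (c : ℝ) ≤ K * ε ^ (-(κ * w)) * N ^ (1 + ε) := h1
    _ = K * N * (ε ^ (-(κ * w)) * Real.exp (ε * L)) := by rw [hsplit]; ring
    _ = K * N * ((Real.exp 1 / κ) ^ (κ * w) * (L / w) ^ (κ * w)) := by rw [hopt]
    _ ≤ K * N * (C' * (L / w) ^ w * (L / w) ^ (κ * w)) := by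
        apply mul_le_mul_of_nonneg_left _ (by positivity)
        exact mul_le_mul_of_nonneg_right habs hX0
    _ = K * C' * N * (L / w) ^ ((κ + 1) * w) := by rw [← hpow]; ring

/-- **Pointwise `ω`-form ⟹ `ε`-form, every `ε > 0`.** If `c ≤ K N ((log N)/k)^{κk}` (`κ > 0`, `k ≥ 1`,
`2^k ≤ N`, `k! ≤ N`) then `c ≤ K·C·ε^{−κ′k}·N^{1+ε}` for the `κ′, C` of
`BakerXi.exists_div_rpow_le_eps_form`. [folklore] -/
theorem le_epsForm_of_omegaForm {κ κ' K C : ℝ} (hK : 0 ≤ K)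
    (hC : ∀ ε w L : ℝ, 0 < ε → 1 ≤ w → w * Real.log 2 ≤ L → w * Real.log w - w ≤ L →
      (L / w) ^ (κ * w) ≤ C * ε ^ (-(κ' * w)) * Real.exp (ε * L))
    {a b c k : ℕ} (ht : IsABCTriple a b c) (hk : 1 ≤ k) (h2 : 2 ^ k ≤ rad a b c)
    (hf : k ! ≤ rad a b c)
    (hΩ : (c : ℝ) ≤ K * ((rad a b c : ℕ) : ℝ) *
      (Real.log ((rad a b c : ℕ) : ℝ) / (k : ℝ)) ^ (κ * (k : ℝ)))
    {ε : ℝ} (hε : 0 < ε) :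
    (c : ℝ) ≤ K * C * ε ^ (-(κ' * (k : ℝ))) * ((rad a b c : ℕ) : ℝ) ^ (1 + ε) := by
  set N : ℝ := ((rad a b c : ℕ) : ℝ) with hN
  set w : ℝ := (k : ℝ) with hw
  set L : ℝ := Real.log N with hL
  have hN2 : (2 : ℝ) ≤ N := by rw [hN]; exact_mod_cast ht.two_le_rad
  have hN0 : 0 < N := by linarith
  have hw1 : (1 : ℝ) ≤ w := by rw [hw]; exact_mod_cast hk
  have hlog2 : w * Real.log 2 ≤ L := BakerXi.mul_log_two_le_log h2
  have hfac : w * Real.log w - w ≤ L := BakerXi.mul_log_sub_le_log hf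
  have hsplit : N ^ (1 + ε) = N * Real.exp (ε * L) := by
    rw [Real.rpow_add hN0, Real.rpow_one, Real.rpow_def_of_pos hN0, hL, mul_comm (Real.log N)]
  have h1 := hC ε w L hε hw1 hlog2 hfac
  calc (c : ℝ) ≤ K * N * (L / w) ^ (κ * w) := hΩ
    _ ≤ K * N * (C * ε ^ (-(κ' * w)) * Real.exp (ε * L)) :=
        mul_le_mul_of_nonneg_left h1 (by positivity)
    _ = K * C * ε ^ (-(κ' * w)) * N ^ (1 + ε) := by rw [hsplit]; ring

/-! ## §1 The cell's labelling: `BakerRefinedABC ↔ BakerOmegaConjecture` (Baker 1998 `ε`-form ⟺ Baker 2004 Conj. 3) -/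

/-- An abc triple with `ω(ab) = 0` is `1 + 1 = 2` (so `c = rad(abc) = 2`). [folklore] -/
theorem eq_of_cardDistinctFactors_mul_eq_zero {a b c : ℕ} (ht : IsABCTriple a b c)
    (h0 : ω (a * b) = 0) : a = 1 ∧ b = 1 ∧ c = 2 := by
  obtain ⟨ha, hb, hc, habc⟩ := soloInformed_xi_triple_pos ht
  have hab : ¬ 1 < a * b := fun h =>
    (Nat.lt_irrefl 0) (lt_of_lt_of_eq (ArithmeticFunction.cardDistinctFactors_pos.mpr h) h0)
  have ha1 : a = 1 := by nlinarith
  have hb1 : b = 1 := by nlinarith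
  exact ⟨ha1, hb1, by omega⟩

/-- **`ε`-form ⟹ `ω`-form (cell labelling).** Baker 1998 `⟹` Baker 2004 Conj. 3, by Granville's
`ε = κω/log N` and absorption of `(e/κ)^{κω}` into `((log N)/ω)^{ω}` (`κ ↦ κ + 1`).
[cite: Waldschmidt2014, §5] [cite: Philippon1999, §3(b) (p. 331)] -/
theorem bakerOmegaConjecture_of_bakerRefinedABC (h : BakerRefinedABC) : BakerOmegaConjecture := by
  obtain ⟨κ, K, hκ, hK, hE⟩ := h
  obtain ⟨C', hC'1, hC'⟩ :=
    BakerXi.exists_const_rpow_le_mul_div_rpow (le_max_left 1 ((Real.exp 1 / κ) ^ κ))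
  refine ⟨κ + 1, K * C' + 1, fun a b c ht => ?_⟩
  have hN2 : (2 : ℝ) ≤ ((rad a b c : ℕ) : ℝ) := by exact_mod_cast ht.two_le_rad
  rcases Nat.eq_zero_or_pos (ω (a * b)) with h0 | hpos
  · -- the triple `1 + 1 = 2`
    obtain ⟨rfl, rfl, rfl⟩ := eq_of_cardDistinctFactors_mul_eq_zero ht h0
    rw [h0, Nat.cast_zero, mul_zero, Real.rpow_zero, mul_one, rad_one_one_two]
    push_cast
    nlinarith
  · have hmain := le_omegaForm_of_epsForm hκ hK.le hC' ht hpos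
      (two_pow_cardDistinctFactors_le_rad_of_dvd ht ⟨c, rfl⟩)
      (factorial_cardDistinctFactors_le_rad_of_dvd ht ⟨c, rfl⟩) (fun ε hε => hE ε hε a b c ht)
    have hX : 0 ≤ ((rad a b c : ℕ) : ℝ) *
        (Real.log ((rad a b c : ℕ) : ℝ) / (ω (a * b) : ℝ)) ^ ((κ + 1) * (ω (a * b) : ℝ)) :=
      mul_nonneg (by positivity) (Real.rpow_nonneg (div_nonneg (Real.log_nonneg (by linarith))
        (Nat.cast_nonneg _)) _)
    calc (c : ℝ) ≤ K * C' * ((rad a b c : ℕ) : ℝ) *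
          (Real.log ((rad a b c : ℕ) : ℝ) / (ω (a * b) : ℝ)) ^ ((κ + 1) * (ω (a * b) : ℝ)) := hmain
      _ ≤ (K * C' + 1) * ((rad a b c : ℕ) : ℝ) *
          (Real.log ((rad a b c : ℕ) : ℝ) / (ω (a * b) : ℝ)) ^ ((κ + 1) * (ω (a * b) : ℝ)) := by
          rw [mul_assoc, mul_assoc (K * C' + 1)]; exact mul_le_mul_of_nonneg_right (by linarith) hX

/-- **`ω`-form ⟹ `ε`-form (cell labelling), for every `ε > 0`.** Baker 2004 Conj. 3 `⟹` Baker 1998: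
`((log N)/ω)^{κω} ≤ C ε^{−κ′ω} N^{ε}` (`BakerXi.exists_div_rpow_le_eps_form`, after normalising the cell's
unrestricted `κ, K` to `max κ 1`, `|K|` using `(log N)/ω(ab) ≥ 1`, `cardDistinctFactors_mul_le_log_rad`).
[cite: Philippon1999, §3(b) (p. 331)] -/
theorem bakerRefinedABC_of_bakerOmegaConjecture (h : BakerOmegaConjecture) : BakerRefinedABC := by
  obtain ⟨κ, K, hΩ⟩ := h
  have hκ1 : 0 < max κ 1 := lt_of_lt_of_le one_pos (le_max_right κ 1)
  obtain ⟨κ', C, hκ', hC1, hC⟩ := BakerXi.exists_div_rpow_le_eps_form hκ1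
  refine ⟨κ', |K| * C + 1, hκ', by positivity, fun ε hε a b c ht => ?_⟩
  have hN2 : (2 : ℝ) ≤ ((rad a b c : ℕ) : ℝ) := by exact_mod_cast ht.two_le_rad
  have hN0 : (0 : ℝ) < ((rad a b c : ℕ) : ℝ) := by linarith
  have hNε : ((rad a b c : ℕ) : ℝ) ≤ ((rad a b c : ℕ) : ℝ) ^ (1 + ε) := by
    calc ((rad a b c : ℕ) : ℝ) = ((rad a b c : ℕ) : ℝ) ^ (1 : ℝ) := (Real.rpow_one _).symm
      _ ≤ ((rad a b c : ℕ) : ℝ) ^ (1 + ε) :=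
          Real.rpow_le_rpow_of_exponent_le (by linarith) (by linarith)
  rcases Nat.eq_zero_or_pos (ω (a * b)) with h0 | hpos
  · -- the triple `1 + 1 = 2`
    obtain ⟨rfl, rfl, rfl⟩ := eq_of_cardDistinctFactors_mul_eq_zero ht h0
    rw [h0, Nat.cast_zero, mul_zero, neg_zero, Real.rpow_zero, mul_one]
    rw [rad_one_one_two] at hNε ⊢
    push_cast at hNε ⊢
    have hC0 : 0 ≤ |K| * C := by positivity
    nlinarith [hNε, hC0]
  · have hB := hΩ a b c ht
    set N : ℝ := ((rad a b c : ℕ) : ℝ) with hN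
    set w : ℝ := (ω (a * b) : ℝ) with hw
    set L : ℝ := Real.log N with hL
    have hw0 : 0 < w := by rw [hw]; exact_mod_cast hpos
    have hs1 : 1 ≤ L / w := by
      rw [le_div_iff₀ hw0, one_mul, hL, hw, hN]; exact cardDistinctFactors_mul_le_log_rad ht
    have hX0 : 0 ≤ (L / w) ^ (κ * w) := Real.rpow_nonneg (by linarith) _
    have hB' : (c : ℝ) ≤ |K| * N * (L / w) ^ (max κ 1 * w) := by
      calc (c : ℝ) ≤ K * N * (L / w) ^ (κ * w) := hB
        _ ≤ |K| * N * (L / w) ^ (κ * w) :=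
            mul_le_mul_of_nonneg_right (mul_le_mul_of_nonneg_right (le_abs_self K) hN0.le) hX0
        _ ≤ |K| * N * (L / w) ^ (max κ 1 * w) := by
            apply mul_le_mul_of_nonneg_left _ (by positivity)
            exact Real.rpow_le_rpow_of_exponent_le hs1
              (mul_le_mul_of_nonneg_right (le_max_left κ 1) hw0.le)
    have hmain := le_epsForm_of_omegaForm (abs_nonneg K) hC ht hpos
      (two_pow_cardDistinctFactors_le_rad_of_dvd ht ⟨c, rfl⟩)
      (factorial_cardDistinctFactors_le_rad_of_dvd ht ⟨c, rfl⟩) hB' hε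
    have hY : 0 ≤ ε ^ (-(κ' * w)) * N ^ (1 + ε) :=
      mul_nonneg (Real.rpow_nonneg hε.le _) (Real.rpow_nonneg hN0.le _)
    calc (c : ℝ) ≤ |K| * C * ε ^ (-(κ' * w)) * N ^ (1 + ε) := hmain
      _ ≤ (|K| * C + 1) * ε ^ (-(κ' * w)) * N ^ (1 + ε) := by
          rw [mul_assoc, mul_assoc (|K| * C + 1)]; exact mul_le_mul_of_nonneg_right (by linarith) hY

/-- **GLUE (PROVED): Baker 1998's `ε`-form ⟺ Baker 2004's Conjecture 3** in the cell's labelling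
(`ω` of the two summands). [cite: Philippon1999, §3(b) (p. 331)] [cite: Waldschmidt2014, §5] -/
theorem bakerRefinedABC_iff_bakerOmegaConjecture : BakerRefinedABC ↔ BakerOmegaConjecture :=
  ⟨bakerOmegaConjecture_of_bakerRefinedABC, bakerRefinedABC_of_bakerOmegaConjecture⟩

/-- **GLUE (PROVED), door C9: Baker 1998's refined abc (`ε`-form) ⟹ abc** (via Conj. 3 and
`bakerOmega_imp_abc`). A0 DOOR: a stronger hypothesis implies abc; abc is not proved by this.
[cite: EtessamiStewartYannakakis2014, Conj. 3.4] [cite: Baker1998] -/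
theorem abc_of_bakerRefinedABC (h : BakerRefinedABC) : _root_.ABC :=
  bakerOmega_imp_abc (bakerOmegaConjecture_of_bakerRefinedABC h)

/-! ## §2 Baker's pair labelling `ω(c·a)`: `ε`-form ⟺ `ω`-form (the `Ξ`-form itself is treated in `GlueBakerXiForm.lean`) -/

/-- **`ε`-form ⟺ `ω`-form in Baker's pair labelling `ω(c·a)`** (the same optimisation; the `ω`-form is
VERBATIM the hypothesis of `Summit.ABC.ABC.Theorems.soloInformed_abc_of_bakerConj3`). [folklore] -/
theorem refinedPairs_iff_omegaPairs :
    (∃ κ : ℝ, 0 < κ ∧ ∃ K : ℝ, 0 < K ∧ ∀ ε : ℝ, 0 < ε → ∀ a b c : ℕ, IsABCTriple a b c →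
        (c : ℝ) ≤ K * ε ^ (-(κ * (ω (c * a) : ℝ))) * ((rad a b c : ℕ) : ℝ) ^ (1 + ε)) ↔
      ∃ κ : ℝ, 0 < κ ∧ ∃ K : ℝ, 0 < K ∧ ∀ a b c : ℕ, IsABCTriple a b c →
        (c : ℝ) ≤ K * ((rad a b c : ℕ) : ℝ) *
          (Real.log ((rad a b c : ℕ) : ℝ) / ω (c * a)) ^ (κ * ω (c * a)) := by
  constructor
  · rintro ⟨κ, hκ, K, hK, hE⟩
    obtain ⟨C', hC'1, hC'⟩ :=
      BakerXi.exists_const_rpow_le_mul_div_rpow (le_max_left 1 ((Real.exp 1 / κ) ^ κ))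
    refine ⟨κ + 1, by positivity, K * C', by positivity, fun a b c ht => ?_⟩
    have hdvd : c * a ∣ a * b * c := ⟨b, by ring⟩
    exact le_omegaForm_of_epsForm hκ hK.le hC' ht (soloInformed_one_le_omega_ca ht)
      (two_pow_cardDistinctFactors_le_rad_of_dvd ht hdvd)
      (factorial_cardDistinctFactors_le_rad_of_dvd ht hdvd) (fun ε hε => hE ε hε a b c ht)
  · rintro ⟨κ, hκ, K, hK, hΩ⟩
    obtain ⟨κ', C, hκ', hC1, hC⟩ := BakerXi.exists_div_rpow_le_eps_form hκ
    refine ⟨κ', hκ', K * C, by positivity, fun ε hε a b c ht => ?_⟩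
    have hdvd : c * a ∣ a * b * c := ⟨b, by ring⟩
    exact le_epsForm_of_omegaForm hK.le hC ht (soloInformed_one_le_omega_ca ht)
      (two_pow_cardDistinctFactors_le_rad_of_dvd ht hdvd)
      (factorial_cardDistinctFactors_le_rad_of_dvd ht hdvd) (hΩ a b c ht) hε

end Summit.ABC.Harvest

end
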